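import Literature.MathematicalPhysics.QuantumFieldTheory.Balaban1983to89.Node00.Record12BgRowCoClassCP

/-!
# NODE 00 — ROW P11 UNDER F7 ∕ v1.5 `CoP`, GUARDED EDITION: the top-domain [15] fact WITH PRINT'S LETTER `M₁ ≥ 1` — `VariationalThm1RegSepTop7M F N Sup B₃ a₀ a₁`,
# `VariationalThm1RegSepCoP7M F N B₃ a₀ a₁` — and the row's suppliers re-keyed to it (LOCATED-P11-EMPTY-SUPPORT, self-located)

Cell `pub-ymgap`, seat `pub-ymgap-node00-def-P11` g3 (R218; pen of record for the [15]-fact leaves, director-ym №160 (6)).  This seat's LOCATED-P11-EMPTY-SUPPORT (cell bus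
INBOX l.18760, Lean-probed): FILE 12b's `VariationalThm1RegSepTop7` and FILE 12c's `VariationalThm1RegSepCoP7` quantify `∀ ν : Stage7Numerics` INSIDE the sentence, and
`Stage7Numerics.M₁ : ℕ` admits `M₁ = 0`; there `cubeIndices (F.P K) 0 = ∅` (`Finset.range ((n + 0 − 1) ∕ 0) = ∅`), hence `hullD (F.P K) 0 n X = ∅` and node00-def-R's support
`suppDomOfRecord F ν K Ω = hullD (F.P K) ν.M₁ 1 (Ω 1) = ∅`.  At such `ν` all three scale-`0` clauses of the CoP sentence — class (1.7)₀∕(1.9)₀, datum (7)₀ (`Sect2.DataSmall7PTop … ∅ …`),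
conclusion (8)₀ — are VACUOUS, while (8)₁ still ranges over `plaqsOf (s.Ω 1)`, which on the torus contains ALL-PINNED plaquettes (one corner in `Ω₁`, two crossing bonds and two outside
bonds, all pinned by `genSet`'s `Γ₀ = Ω₁ᶜ`) that no hypothesis constrains beyond the class's `ε₀·η₁²`: with `k = 1` (separation vacuous), one 𝐃₁-cube `D`, `W 0 := 1` except one pinned
bond outside a corner of `D` twisted by a small `t` (`0 < t ≪ ε₀η₁²`, so that a minimiser exists in the open class by dag-n07-e's small-action lemma), the sentence demands `t < B₃δ₁η₁²`
while the data (7)₁ only force `δ₁ > 4t∕L³` (dag-n21-c's single-bond average bound) — `¬VariationalThm1RegSepCoP7` for every `B₃ ≤ L⁵∕4`,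
and for every `B₃` once the twist is made (7)-invisible by compensating bonds (block averages are many-to-one).  With `M₁ ≥ 1` neither mechanism exists: the support contains `Ω₁` plus a
layer of `M₁`-cubes, so every all-pinned plaquette meeting `Ω₁` is a (7)₀ plaquette (pinned at `δ₀ ≤ 2δ₁`, leaving the displayed floor `2L² ≤ B₃`), and `Sect2.SeqSeparated` keeps the deeper
`Ω_j` off `∂Ω₁`.  Print: `M₁` is a POSITIVE integer ([6] (1.3)–(1.6): «Ω_n is a union of LⁿξM₁-cubes»; [15] p.277 (1) «Ω₀ ⊇ Ω₁», false at the empty support).  CLASS: degenerate-instance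
defect of the typed sentence (a universally quantified letter left free below — the class of LOCATED-M4's `δ 0`).  REPAIR = ONE BINDER, print's letter: `0 < ν.M₁ →` right after the
separation arrow.  FILE 12b∕12c stay byte-identical (the unguarded sentences are the stronger ones: `….toTop7M` ∕ `….toCoP7M`).  FLOOR OF RECORD (dag-n21-c g8, kernel
certificate `Summits/…/BalabanUVNodesK0VariationalThm1Top7Floor.lean` p522857: `two_sq_L_le_of_variationalThm1RegSepTop7 (Sup) (hN : 2 ≤ N) (ha₀ : 0 < a₀) (ha₁ : 0 < a₁) :
VariationalThm1RegSepTop7 F N Sup B₃ a₀ a₁ → 2·L² ≤ B₃`): the displayed floor `2L² ≤ B₃` is a theorem for the unguarded sentence at every selector; its witness has `M₁ ≥ 1`, so the same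
floor is expected for the guarded sentences below (consumers display `2L² ≤ B₃`; print: `B₃ = B₃(d, L)`, [15] p.279).

CONTENTS.  §1 ★★ `VariationalThm1RegSepTop7M F N Sup B₃ a₀ a₁` (def, NEVER asserted; 12b's text + the binder), `.of_le`, `VariationalThm1RegSepTop7.toTop7M`; §2 suppliers generic in the
minimiser and in `Sup`: `plaqSmallOn_∕coDivSmallOn_of_thm1RegSepTop7M`, ★★★ `bgRowAtDatumU_of_thm1RegSepTop7MC1` (12b's binder lists with `(hM₁ : 0 < ν.M₁)` right after `hsep`); §3 ★★
`VariationalThm1RegSepCoP7M F N B₃ a₀ a₁ := …Top7M … (fun ν K Ω => suppDomOfRecord F ν K Ω) …` (the citeable token of the v1.5 `bg` road), `.toTop7M ∕ ….toCoP7M` (definitional), `.of_le`,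
`VariationalThm1RegSepCoP7.toCoP7M`, `plaqSmallOn_∕coDivSmallOn_UbgMSCoPOfRecord_of_thm1RegSepCoP7M`, ★★★ `bgRowAtDatumCoP_of_thm1RegSepCoP7MC1` — ROW P11's body at `(s, 𝐖)` for
node00-def-R's `UbgMSCoPOfRecord … s 𝐖` from the GUARDED fact (the supplier node00-def-K0a's CoP closers key on).

HONEST FRAMING.  Statement architecture + bookkeeping around ONE NAMED FACT (a `Prop`, NEVER asserted) and its specialisation; nothing of Bałaban asserted or discharged; K0⁵ NOT closed;
counts unmoved (typed 28∕28 · discharged 5∕28); one finite `𝕋⁴` torus family at fixed `ε = L^{−K}`; not continuum ∕ OS ∕ mass gap ∕ Clay.  Two `def`s, no `instance`, no `sorry`.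

DEPENDENCES (by name): FILE 12a `Node00.Record12BgRowTopDomain` (`Sect2.omegaPlaqsTop(_of_ne_zero)`, `Sect2.omegaBondsTop`, `Sect2.CoDivClassOnTop`, `Sect2.DataSmall7PTop`,
`bgRowAtDatumU_of_classBoundsC1Pos`), FILE 12b `Node00.Record12BgRowTopClass` (`VariationalThm1RegSepTop7`), FILE 12c `Node00.Record12BgRowCoClassCP` (`VariationalThm1RegSepCoP7`),
node00-def-R FILE 22′ `Node00.LargeFieldBackgroundCoPOfRecord` (`suppDomOfRecord`, `regMSCoPOfRecord`, `UbgMSCoPOfRecord`, `isMinimizer_UbgMSCoPOfRecord`, `UbgMSCoPOfRecord_eq_one_of_not_mem`),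
FILE 10 `bgRowAtDatum_one`, FILE 7c (`hletterI∕MS_of_numerics`), r11 `IsMinimizer`, `avOfRecord`, `genSet`, `epsOfRecord`, FILE 2 `Sect2.SeqSeparated`.
-/

noncomputable section

open MeasureTheory
open scoped Matrix.Norms.L2Operator

namespace Literature.MathematicalPhysics.QuantumFieldTheory.Balaban1983to89.Node00

open T4Continuum B14.Eq218Concrete B15DeterminingSets B12RegularSpaces111 B14RegularSpaces234 B14Radii T4AxialGaugeSmallField

/-! ## §1  The top-domain fact WITH PRINT'S LETTER `M₁ ≥ 1` -/

section NamedFactTopM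

variable (F : T4Family) (N : ℕ) [NeZero N]

/-- **★★ NAMED FACT, GUARDED TOP-DOMAIN EDITION — [15] THEOREM 1, (R)-READING, OVER PRINT'S CLASS (6) OF CONFIGURATIONS ON THE SUPPORT `Ω₀ = Sup ν K s.Ω`, THRESHOLDS COMPARABLE
BOTH WAYS, AT NUMERICS WITH `M₁ ≥ 1`** (a `Prop` with parameters, NEVER asserted): FILE 12b's `VariationalThm1RegSepTop7` with ONE binder added right after the separation clause —
`0 < ν.M₁`, print's letter ([6] (1.3)–(1.6): the domains are unions of `LⁿξM₁`-cubes, `M₁` a positive integer) — which excludes the degenerate instance `M₁ = 0` where node00-def-R's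
support `hullD … ν.M₁ 1 (Ω 1)` is EMPTY and [15] (1) «Ω₀ ⊇ Ω₁» fails (LOCATED-P11-EMPTY-SUPPORT, module docstring).  Everything else — separated `s`, `0 < δ_n ≤ a₁`, `B₃δ_n ≤ ε₀ ≤ a₀`,
`δ_n ≤ 2δ_{n+1}` and `δ_{n+1} ≤ 2δ_n`, datum with (7) on the support (`Sect2.DataSmall7PTop`), EVERY minimiser over the top-domain class (6) lies in (8) with scale `0` read on the
support — byte for byte 12b's.  Inhabitation floor displayed by consumers: `2L² ≤ B₃`.
-- TODO(general form): ONE threshold ε₁ in print; general admissible `{Ω_j}`∕`𝔅_k` ([6] Sect. A) and print's separation letter `R ≥ R₁`; orbit uniqueness and (9)–(10) are not part of this sentence.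
[cite: Balaban1985Variational, (1) p.277, Thm 1 (2),(3),(5),(6),(7)–(8) pp.278–279; Balaban1985RegularSpaces, (1.1)–(1.2) p.76, (1.3)–(1.9) p.77; Balaban1988Convergent, p.255, (2.6)–(2.8) pp.255–256, (2.12) p.256] -/
def VariationalThm1RegSepTop7M (Sup : (ν : Stage7Numerics) → (K : ℕ) → (ℕ → Set (Site (F.P K) 0)) → Set (Site (F.P K) 0)) (B₃ a₀ a₁ : ℝ) : Prop :=
  ∀ (ν : Stage7Numerics) (M : ℕ) (g : ℕ → ℝ) (K k : ℕ) (s : SeqOfRecord F ν M g K k), Sect2.SeqSeparated ν.M₁ s → 0 < ν.M₁ → ∀ (ε₀ : ℝ) (δ : ℕ → ℝ),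
    (∀ n, n ≤ k → 0 < δ n ∧ δ n ≤ a₁ ∧ B₃ * δ n ≤ ε₀) → (∀ n, n < k → δ n ≤ 2 * δ (n + 1)) → (∀ n, n < k → δ (n + 1) ≤ 2 * δ n) → ε₀ ≤ a₀ →
    ∀ W : MSField (F.P K) (SU N), Sect2.DataSmall7PTop (avOfRecord F N K) s.Ω (Sup ν K s.Ω) k δ W →
      ∀ U₀, IsMinimizer (avOfRecord F N K)
          {U | (∀ n, n ≤ k → PlaqSmallOn (Sect2.omegaPlaqsTop s.Ω (Sup ν K s.Ω) n) (ε₀ * (F.P K).eta n ^ 2) U) ∧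
            Sect2.CoDivClassOnTop s.Ω (Sup ν K s.Ω) k ε₀ U} (genSet s.Ω k) W U₀ →
        (∀ n, n ≤ k → PlaqSmallOn (Sect2.omegaPlaqsTop s.Ω (Sup ν K s.Ω) n) (B₃ * δ n * (F.P K).eta n ^ 2) U₀) ∧
          ∀ n, n ≤ k → Sect2.CoDivSmallOn (Sect2.omegaBondsTop s.Ω (Sup ν K s.Ω) n) (B₃ * δ n * (F.P K).eta n ^ 3) U₀

variable {F N}

/-- The guarded top-domain fact is ANTITONE in `a₀`, `a₁`. [cite: Balaban1985Variational, Thm 1 p.279 (the range «ε₀ ≤ a₀», «ε₁ ≤ a₁»)] -/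
theorem VariationalThm1RegSepTop7M.of_le {Sup : (ν : Stage7Numerics) → (K : ℕ) → (ℕ → Set (Site (F.P K) 0)) → Set (Site (F.P K) 0)} {B₃ a₀ a₀' a₁ a₁' : ℝ}
    (h : VariationalThm1RegSepTop7M F N Sup B₃ a₀ a₁) (ha₀ : a₀' ≤ a₀) (ha₁ : a₁' ≤ a₁) : VariationalThm1RegSepTop7M F N Sup B₃ a₀' a₁' :=
  fun ν M g K k s hsep hM₁ ε₀ δ hnum hcomp hcomp' hε W h7 U₀ hmin =>
    h ν M g K k s hsep hM₁ ε₀ δ (fun n hn => ⟨(hnum n hn).1, (hnum n hn).2.1.trans ha₁, (hnum n hn).2.2⟩) hcomp hcomp' (hε.trans ha₀) W h7 U₀ hmin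

/-- **FILE 12b's UNGUARDED FACT IMPLIES THE GUARDED ONE** (drop the `M₁` hypothesis): `VariationalThm1RegSepTop7` is the STRONGER sentence — and, at node00-def-R's selector, the one with
the located degenerate instance `M₁ = 0` (module docstring). [cite: Balaban1985Variational, Thm 1 (8) p.279 (bookkeeping); Balaban1985RegularSpaces, (1.3) p.77] -/
theorem VariationalThm1RegSepTop7.toTop7M {Sup : (ν : Stage7Numerics) → (K : ℕ) → (ℕ → Set (Site (F.P K) 0)) → Set (Site (F.P K) 0)} {B₃ a₀ a₁ : ℝ}
    (h : VariationalThm1RegSepTop7 F N Sup B₃ a₀ a₁) : VariationalThm1RegSepTop7M F N Sup B₃ a₀ a₁ :=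
  fun ν M g K k s hsep _ ε₀ δ hnum hcomp hcomp' hε W h7 U₀ hmin => h ν M g K k s hsep ε₀ δ hnum hcomp hcomp' hε W h7 U₀ hmin

end NamedFactTopM

/-! ## §2  Suppliers GENERIC IN THE MINIMISER over the top-domain class (6), keyed to the guarded fact (12b §2 with `(hM₁ : 0 < ν.M₁)` after `hsep`) -/

section SuppliersTopM

variable {F : T4Family} {N : ℕ} [NeZero N]

/-- **★ EVERY MINIMISER OVER THE TOP-DOMAIN CLASS (6) AT THE RECORD'S LETTERS IS `B₃·cR·ε_n`-REGULAR (plaquettes meeting `Ω_n`, scale 0 on the support)** for a separated sequence,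
numerics with `M₁ ≥ 1`, thresholds comparable both ways and a datum with print's (7) on the support, from the GUARDED top-domain fact; `εreg` generic. [cite: Balaban1985Variational, Thm 1 (2),(6)–(8) pp.278–279; Balaban1985RegularSpaces, (1.3) p.77; Balaban1988Convergent, (2.6)–(2.8) pp.255–256, (2.12) p.256] -/
theorem plaqSmallOn_of_thm1RegSepTop7M {Sup : (ν : Stage7Numerics) → (K : ℕ) → (ℕ → Set (Site (F.P K) 0)) → Set (Site (F.P K) 0)} {B₃ a₀ a₁ : ℝ}
    (h15 : VariationalThm1RegSepTop7M F N Sup B₃ a₀ a₁) (ν : Stage7Numerics) (M : ℕ)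
    (g : ℕ → ℝ) (K k : ℕ) (cR : ℝ) (s : SeqOfRecord F ν M g K k) (hsep : Sect2.SeqSeparated ν.M₁ s) (hM₁ : 0 < ν.M₁)
    (hnum : ∀ n, n ≤ k → 0 < cR * epsOfRecord ν g n ∧ cR * epsOfRecord ν g n ≤ a₁ ∧ B₃ * (cR * epsOfRecord ν g n) ≤ ν.εreg) (ha₀ : ν.εreg ≤ a₀)
    (hcomp : ∀ n, n < k → cR * epsOfRecord ν g n ≤ 2 * (cR * epsOfRecord ν g (n + 1)))
    (hcomp' : ∀ n, n < k → cR * epsOfRecord ν g (n + 1) ≤ 2 * (cR * epsOfRecord ν g n))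
    {W : MSField (F.P K) (SU N)} (h7 : Sect2.DataSmall7PTop (avOfRecord F N K) s.Ω (Sup ν K s.Ω) k (fun n => cR * epsOfRecord ν g n) W)
    {U₀ : GaugeField (F.P K) 0 (SU N)} (hmin : IsMinimizer (avOfRecord F N K)
      {U | (∀ n, n ≤ k → PlaqSmallOn (Sect2.omegaPlaqsTop s.Ω (Sup ν K s.Ω) n) (ν.εreg * (F.P K).eta n ^ 2) U) ∧
        Sect2.CoDivClassOnTop s.Ω (Sup ν K s.Ω) k ν.εreg U} (genSet s.Ω k) W U₀) :
    ∀ n, n ≤ k → PlaqSmallOn (Sect2.omegaPlaqsTop s.Ω (Sup ν K s.Ω) n) (B₃ * (cR * epsOfRecord ν g n) * (F.P K).eta n ^ 2) U₀ :=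
  (h15 ν M g K k s hsep hM₁ ν.εreg (fun n => cR * epsOfRecord ν g n) hnum hcomp hcomp' ha₀ W h7 U₀ hmin).1

/-- The co-divergence half ((8)'s second member, scale 0 on the support) for every minimiser over the top-domain class, from the GUARDED fact. [cite: Balaban1985Variational, Thm 1 (8) p.279; Balaban1985RegularSpaces, (1.9) p.77] -/
theorem coDivSmallOn_of_thm1RegSepTop7M {Sup : (ν : Stage7Numerics) → (K : ℕ) → (ℕ → Set (Site (F.P K) 0)) → Set (Site (F.P K) 0)} {B₃ a₀ a₁ : ℝ}
    (h15 : VariationalThm1RegSepTop7M F N Sup B₃ a₀ a₁) (ν : Stage7Numerics) (M : ℕ)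
    (g : ℕ → ℝ) (K k : ℕ) (cR : ℝ) (s : SeqOfRecord F ν M g K k) (hsep : Sect2.SeqSeparated ν.M₁ s) (hM₁ : 0 < ν.M₁)
    (hnum : ∀ n, n ≤ k → 0 < cR * epsOfRecord ν g n ∧ cR * epsOfRecord ν g n ≤ a₁ ∧ B₃ * (cR * epsOfRecord ν g n) ≤ ν.εreg) (ha₀ : ν.εreg ≤ a₀)
    (hcomp : ∀ n, n < k → cR * epsOfRecord ν g n ≤ 2 * (cR * epsOfRecord ν g (n + 1)))
    (hcomp' : ∀ n, n < k → cR * epsOfRecord ν g (n + 1) ≤ 2 * (cR * epsOfRecord ν g n))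
    {W : MSField (F.P K) (SU N)} (h7 : Sect2.DataSmall7PTop (avOfRecord F N K) s.Ω (Sup ν K s.Ω) k (fun n => cR * epsOfRecord ν g n) W)
    {U₀ : GaugeField (F.P K) 0 (SU N)} (hmin : IsMinimizer (avOfRecord F N K)
      {U | (∀ n, n ≤ k → PlaqSmallOn (Sect2.omegaPlaqsTop s.Ω (Sup ν K s.Ω) n) (ν.εreg * (F.P K).eta n ^ 2) U) ∧
        Sect2.CoDivClassOnTop s.Ω (Sup ν K s.Ω) k ν.εreg U} (genSet s.Ω k) W U₀) :
    ∀ n, n ≤ k → Sect2.CoDivSmallOn (Sect2.omegaBondsTop s.Ω (Sup ν K s.Ω) n) (B₃ * (cR * epsOfRecord ν g n) * (F.P K).eta n ^ 3) U₀ :=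
  (h15 ν M g K k s hsep hM₁ ν.εreg (fun n => cR * epsOfRecord ν g n) hnum hcomp hcomp' ha₀ W h7 U₀ hmin).2

/-- **★★★ ROW P11's BODY AT `(s, 𝐖)` FOR EVERY MINIMISER `U₀` OVER THE TOP-DOMAIN CLASS (6), FROM THE GUARDED TOP-DOMAIN FACT** — `VariationalThm1RegSepTop7M` (`0 < M₁`) for the plaquette class bounds
at the scales `1 ≤ n ≤ k` (the scale-0 member, read on the support, is not needed by the row: FILE 12a's `bgRowAtDatumU_of_classBoundsC1Pos`), print's (7) on the datum over the support
(`h7`), the displayed C¹ class clause `B₃′·cR·ε_n·η_n³` for `U₀` ([15] Thm 1 (9)–(10), gauge-free reading), numerics incl. FILE 7c's two «C₀ large» letters, (C1)(C2), no wrapping, `hcomp`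
AND `hcomp'`, `hM₁`.  NO `h9`.  def-R′ instantiates `Sup := suppDomOfRecord`, `U₀ := UbgMSCoPOfRecord … s W` (§3).
[cite: Balaban1985Variational, Thm 1 (2),(6)–(10) pp.278–279; Balaban1985RegularSpaces, (1.3)–(1.9) p.77; Balaban1988Convergent, (2.4)–(2.8) pp.255–256, (2.12) p.256, (2.27)–(2.28) p.259, (2.34)–(2.41) p.261; Balaban1987RG1, (1.11)–(1.16) p.262] -/
theorem bgRowAtDatumU_of_thm1RegSepTop7MC1 {Sup : (ν : Stage7Numerics) → (K : ℕ) → (ℕ → Set (Site (F.P K) 0)) → Set (Site (F.P K) 0)} {B₃ B₃' a₀ a₁ tI tMS : ℝ}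
    (h15 : VariationalThm1RegSepTop7M F N Sup B₃ a₀ a₁)
    (S : Sect2.Setting (MatA N) (SU N)) (hι : S.ι = ιSU N) (h𝓜 : S.𝓜 = B12RegularSpaces111SpecialUnitary.suModel N) (hS : S.Laws) (hpos : S.Pos)
    (ν : Stage7Numerics) {M : ℕ} (hM : 0 < M) (K k : ℕ) (cR : ℝ) (hB₃ : 0 ≤ B₃) (hB₃' : 0 ≤ B₃')
    (hg : ∀ j, 1 ≤ j → j ≤ k → 0 < S.flow.g j ∧ S.flow.g j ^ 2 ≤ Real.exp (-1)) (hpq : ν.p₀ ≤ S.lf.q₀)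
    (hnum : ∀ n, n ≤ k → 0 < cR * epsOfRecord ν S.flow.g n ∧ cR * epsOfRecord ν S.flow.g n ≤ a₁ ∧ B₃ * (cR * epsOfRecord ν S.flow.g n) ≤ ν.εreg)
    (ha₀ : ν.εreg ≤ a₀) (hcomp : ∀ n, n < k → cR * epsOfRecord ν S.flow.g n ≤ 2 * (cR * epsOfRecord ν S.flow.g (n + 1)))
    (hcomp' : ∀ n, n < k → cR * epsOfRecord ν S.flow.g (n + 1) ≤ 2 * (cR * epsOfRecord ν S.flow.g n))
    (hα : ∀ n, 1 ≤ n → n ≤ k → 0 < S.lf.alpha0 (S.flow.g n) ∧ 0 < S.lf.alpha1 (S.flow.g n))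
    (hBα : ∀ n, 1 ≤ n → n ≤ k → B₃ * (cR * epsOfRecord ν S.flow.g n) ≤ (1 - S.βc) * S.lf.alpha0 (S.flow.g n))
    (hΛI0 : 0 ≤ (4 * (B₃ + (((F.P K).d - 1 : ℕ) : ℝ) * (((F.P K).L : ℝ) * M) * B₃') + 16 * ((((F.P K).d - 1 : ℕ) : ℝ) * (((F.P K).L : ℝ) * M)) ^ 2 * B₃ ^ 2 * a₁) * cR * ν.A₀)
    (hΛI : (4 * (B₃ + (((F.P K).d - 1 : ℕ) : ℝ) * (((F.P K).L : ℝ) * M) * B₃') + 16 * ((((F.P K).d - 1 : ℕ) : ℝ) * (((F.P K).L : ℝ) * M)) ^ 2 * B₃ ^ 2 * a₁) * cR * ν.A₀ ≤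
      tI * S.lf.C₀) (htI : tI < S.cB)
    (hΛMS0 : 0 ≤ (4 * (B₃ + (((F.P K).d - 1 : ℕ) : ℝ) * (M : ℝ) * B₃') + 16 * ((((F.P K).d - 1 : ℕ) : ℝ) * (M : ℝ)) ^ 2 * B₃ ^ 2 * a₁) * cR * ν.A₀)
    (hΛMS : (4 * (B₃ + (((F.P K).d - 1 : ℕ) : ℝ) * (M : ℝ) * B₃') + 16 * ((((F.P K).d - 1 : ℕ) : ℝ) * (M : ℝ)) ^ 2 * B₃ ^ 2 * a₁) * cR * ν.A₀ ≤ tMS * S.lf.C₀)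
    (htMS : tMS < S.B * S.C * S.Mr)
    (hsN : ∀ n, 1 ≤ n → n ≤ k + 1 → ((B14.Eq213MaximalDomains.side (F.P K).L M n : ℕ) : ℤ) < (F.P K).sitesPerDir 0)
    (hcB : 2 * (((F.P K).d - 1 : ℕ) : ℝ) * ((F.P K).L * M) < S.cB) (hBCM : 2 * (((F.P K).d - 1 : ℕ) : ℝ) * M < S.B * S.C * S.Mr)
    (hsmallI : ∀ j, 1 ≤ j → j ≤ k → (((F.P K).d - 1 : ℕ) : ℝ) * ((F.P K).L * M) * (F.P K).eta j * (B₃ * (cR * epsOfRecord ν S.flow.g j)) ≤ 1 / 2)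
    (hsmallMS : ∀ n, 1 ≤ n → n ≤ k → (((F.P K).d - 1 : ℕ) : ℝ) * M * (F.P K).eta n * (B₃ * (cR * epsOfRecord ν S.flow.g n)) ≤ 1 / 2)
    (hC1 : ∀ j, 1 ≤ j → j ≤ k → ∃ t : ℕ, 0 < t ∧ RkOfRecord (F.P K).L ν.r (S.flow.g j) = (F.P K).L * t)
    (hC2 : ∀ j, 1 ≤ j → j ≤ k → dCubeSide (F.P K).L M (RkOfRecord (F.P K).L ν.r (S.flow.g j)) j ∣ (F.P K).sitesPerDir 0)
    (s : SeqOfRecord F ν M S.flow.g K k) (hsep : Sect2.SeqSeparated ν.M₁ s) (hM₁ : 0 < ν.M₁) {W : MSField (F.P K) (SU N)}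
    (h7 : Sect2.DataSmall7PTop (avOfRecord F N K) s.Ω (Sup ν K s.Ω) k (fun n => cR * epsOfRecord ν S.flow.g n) W)
    {U₀ : GaugeField (F.P K) 0 (SU N)} (hmin : IsMinimizer (avOfRecord F N K)
      {U | (∀ n, n ≤ k → PlaqSmallOn (Sect2.omegaPlaqsTop s.Ω (Sup ν K s.Ω) n) (ν.εreg * (F.P K).eta n ^ 2) U) ∧
        Sect2.CoDivClassOnTop s.Ω (Sup ν K s.Ω) k ν.εreg U} (genSet s.Ω k) W U₀)
    (hclassC1 : ∀ n, 1 ≤ n → n ≤ k → PlaqC1SmallOn (plaqInside (s.Ω n)) (B₃' * (cR * epsOfRecord ν S.flow.g n) * (F.P K).eta n ^ 3) U₀) :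
    ∀ j, 1 ≤ j → j ≤ k → ∀ X : (Sect2.domSys (F.P K) M j).Dom,
      (Sect2.domSites (F.P K) M j X ⊆ s.Λ j →
        Sect2.ofBackgroundC S.ι (U₀) ∈
          Sect2.spaceI S (Sect2.Residual.unit (F.P K) (MatA N)) M j (Sect2.domSites (F.P K) M j X) (S.lf.alpha0 (S.flow.g j)) (S.lf.alpha1 (S.flow.g j))) ∧
      (Sect2.admB (F.P K) ν M S.flow.g s.Ω s.Λ j (Sect2.domSites (F.P K) M j X) = true →
        Sect2.ofBackgroundC S.ι (U₀) ∈
          Sect2.spaceMS S (Sect2.Residual.unit (F.P K) (MatA N)) M j (Sect2.domSites (F.P K) M j X) s.Ω) := by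
  have hplaq := plaqSmallOn_of_thm1RegSepTop7M h15 ν M S.flow.g K k cR s hsep hM₁ hnum ha₀ hcomp hcomp' h7 hmin
  have hclass : ∀ n, 1 ≤ n → n ≤ k → PlaqSmallOn (omegaPlaqs s.Ω n) (B₃ * (cR * epsOfRecord ν S.flow.g n) * (F.P K).eta n ^ 2) U₀ := by
    intro n hn1 hnk
    have := hplaq n hnk
    rwa [Sect2.omegaPlaqsTop_of_ne_zero _ _ (Nat.one_le_iff_ne_zero.mp hn1)] at this
  exact bgRowAtDatumU_of_classBoundsC1Pos S hι h𝓜 hS hpos ν hM K k (fun n _ hn => mul_nonneg hB₃ (hnum n hn).1.le) (fun n _ hn => mul_nonneg hB₃' (hnum n hn).1.le) s U₀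
    hclass hclassC1 hα hBα hsN hcB hBCM hsmallI hsmallMS hC1 hC2
    (hletterI_of_numerics S.lf ν M hg hpq (fun j hj => ⟨(hnum j hj).1, (hnum j hj).2.1⟩) hΛI0 hΛI htI (fun j h1 hj => (hα j h1 hj).1))
    (hletterMS_of_numerics S.lf ν M hg hpq (fun n hn => ⟨(hnum n hn).1, (hnum n hn).2.1⟩) hΛMS0 hΛMS htMS (fun n h1 hn => (hα n h1 hn).1))


end SuppliersTopM

/-! ## §3  The guarded fact AT THE SUPPORT OF RECORD and the suppliers at node00-def-R's `UbgMSCoPOfRecord … s 𝐖` — the v1.5 `bg` supplier on the GUARDED fact -/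

section AtRecordCoPM

variable (F : T4Family) (N : ℕ) [NeZero N]

/-- **★★ NAMED FACT, v1.5 `CoP` EDITION, GUARDED — [15] THEOREM 1 (R) OVER CLASS (6) ON THE SUPPORT OF RECORD `suppDomOfRecord`, `M₁ ≥ 1`, TWO-SIDED COMPARABILITY**: §1's
`VariationalThm1RegSepTop7M` at the selector `Sup := suppDomOfRecord` (so its class literal is node00-def-R's `regMSCoPOfRecord F N ν K k s.Ω` with `ε₀` for `εreg`, by `rfl`).  The citeable
token of the v1.5 `bg` road; a `Prop` with parameters, NEVER asserted.  Inhabitation floor displayed by consumers: `2L² ≤ B₃`.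
-- TODO(general form): ONE threshold ε₁ in print; general admissible `{Ω_j}`∕`𝔅_k` ([6] Sect. A) and print's separation letter `R ≥ R₁`; orbit uniqueness and (9)–(10) are not part of this sentence.
[cite: Balaban1985Variational, (1) p.277, Thm 1 (2),(3),(5),(6),(7)–(8) pp.278–279; Balaban1985RegularSpaces, (1.3)–(1.9) p.77; Balaban1988Convergent, p.255, (2.6)–(2.8) pp.255–256, (2.12) p.256] -/
def VariationalThm1RegSepCoP7M (B₃ a₀ a₁ : ℝ) : Prop :=
  VariationalThm1RegSepTop7M F N (fun ν K Ω => suppDomOfRecord F ν K Ω) B₃ a₀ a₁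

variable {F N}

/-- Definitional bridge to the guarded top-domain fact at the selector of record. [cite: Balaban1985Variational, Thm 1 (8) p.279 (bookkeeping)] -/
theorem VariationalThm1RegSepCoP7M.toTop7M {B₃ a₀ a₁ : ℝ} (h : VariationalThm1RegSepCoP7M F N B₃ a₀ a₁) :
    VariationalThm1RegSepTop7M F N (fun ν K Ω => suppDomOfRecord F ν K Ω) B₃ a₀ a₁ := h

/-- Conversely (definitional). [cite: Balaban1985Variational, Thm 1 (8) p.279 (bookkeeping)] -/
theorem VariationalThm1RegSepTop7M.toCoP7M {B₃ a₀ a₁ : ℝ} (h : VariationalThm1RegSepTop7M F N (fun ν K Ω => suppDomOfRecord F ν K Ω) B₃ a₀ a₁) :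
    VariationalThm1RegSepCoP7M F N B₃ a₀ a₁ := h

/-- The guarded `CoP` fact is ANTITONE in `a₀`, `a₁`. [cite: Balaban1985Variational, Thm 1 p.279 (the range «ε₀ ≤ a₀», «ε₁ ≤ a₁»)] -/
theorem VariationalThm1RegSepCoP7M.of_le {B₃ a₀ a₀' a₁ a₁' : ℝ} (h : VariationalThm1RegSepCoP7M F N B₃ a₀ a₁) (ha₀ : a₀' ≤ a₀) (ha₁ : a₁' ≤ a₁) :
    VariationalThm1RegSepCoP7M F N B₃ a₀' a₁' :=
  VariationalThm1RegSepTop7M.of_le h ha₀ ha₁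

/-- FILE 12c's UNGUARDED `CoP` fact implies the guarded one. [cite: Balaban1985Variational, Thm 1 (8) p.279 (bookkeeping); Balaban1985RegularSpaces, (1.3) p.77] -/
theorem VariationalThm1RegSepCoP7.toCoP7M {B₃ a₀ a₁ : ℝ} (h : VariationalThm1RegSepCoP7 F N B₃ a₀ a₁) : VariationalThm1RegSepCoP7M F N B₃ a₀ a₁ :=
  VariationalThm1RegSepTop7.toTop7M h

/-- **★ def-R's COLLAR-CLASS BACKGROUND `UbgMSCoPOfRecord … s 𝐖` IS `B₃·cR·ε_n`-REGULAR AT EVERY SCALE ON THE SOLVABLE SET** (plaquette half of (8); scale 0 on the support), from the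
GUARDED `CoP` fact (`0 < M₁`), for a separated sequence, thresholds comparable both ways and a datum with print's (7) on the support (`h7`). [cite: Balaban1985Variational, Thm 1 (2),(6)–(8) pp.278–279; Balaban1985RegularSpaces, (1.3) p.77; Balaban1988Convergent, (2.6)–(2.8) pp.255–256, (2.12) p.256] -/
theorem plaqSmallOn_UbgMSCoPOfRecord_of_thm1RegSepCoP7M {B₃ a₀ a₁ : ℝ} (h15 : VariationalThm1RegSepCoP7M F N B₃ a₀ a₁) (ν : Stage7Numerics) (M : ℕ)
    (g : ℕ → ℝ) (K k : ℕ) (cR : ℝ) (s : SeqOfRecord F ν M g K k) (hsep : Sect2.SeqSeparated ν.M₁ s) (hM₁ : 0 < ν.M₁)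
    (hnum : ∀ n, n ≤ k → 0 < cR * epsOfRecord ν g n ∧ cR * epsOfRecord ν g n ≤ a₁ ∧ B₃ * (cR * epsOfRecord ν g n) ≤ ν.εreg) (ha₀ : ν.εreg ≤ a₀)
    (hcomp : ∀ n, n < k → cR * epsOfRecord ν g n ≤ 2 * (cR * epsOfRecord ν g (n + 1)))
    (hcomp' : ∀ n, n < k → cR * epsOfRecord ν g (n + 1) ≤ 2 * (cR * epsOfRecord ν g n))
    {W : MSField (F.P K) (SU N)} (h7 : Sect2.DataSmall7PTop (avOfRecord F N K) s.Ω (suppDomOfRecord F ν K s.Ω) k (fun n => cR * epsOfRecord ν g n) W)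
    (hsol : W ∈ solvableDom (avOfRecord F N K) (regMSCoPOfRecord F N ν K k s.Ω) (genSet s.Ω k)) :
    ∀ n, n ≤ k → PlaqSmallOn (Sect2.omegaPlaqsTop s.Ω (suppDomOfRecord F ν K s.Ω) n) (B₃ * (cR * epsOfRecord ν g n) * (F.P K).eta n ^ 2) (UbgMSCoPOfRecord F N ν M g K k s W) :=
  plaqSmallOn_of_thm1RegSepTop7M h15 ν M g K k cR s hsep hM₁ hnum ha₀ hcomp hcomp' h7 (isMinimizer_UbgMSCoPOfRecord ν M g K k s hsol)

/-- The co-divergence half of (8) at def-R's collar-class background on the solvable set (scale 0 on the support), from the GUARDED `CoP` fact. [cite: Balaban1985Variational, Thm 1 (8) p.279; Balaban1985RegularSpaces, (1.9) p.77] -/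
theorem coDivSmallOn_UbgMSCoPOfRecord_of_thm1RegSepCoP7M {B₃ a₀ a₁ : ℝ} (h15 : VariationalThm1RegSepCoP7M F N B₃ a₀ a₁) (ν : Stage7Numerics) (M : ℕ)
    (g : ℕ → ℝ) (K k : ℕ) (cR : ℝ) (s : SeqOfRecord F ν M g K k) (hsep : Sect2.SeqSeparated ν.M₁ s) (hM₁ : 0 < ν.M₁)
    (hnum : ∀ n, n ≤ k → 0 < cR * epsOfRecord ν g n ∧ cR * epsOfRecord ν g n ≤ a₁ ∧ B₃ * (cR * epsOfRecord ν g n) ≤ ν.εreg) (ha₀ : ν.εreg ≤ a₀)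
    (hcomp : ∀ n, n < k → cR * epsOfRecord ν g n ≤ 2 * (cR * epsOfRecord ν g (n + 1)))
    (hcomp' : ∀ n, n < k → cR * epsOfRecord ν g (n + 1) ≤ 2 * (cR * epsOfRecord ν g n))
    {W : MSField (F.P K) (SU N)} (h7 : Sect2.DataSmall7PTop (avOfRecord F N K) s.Ω (suppDomOfRecord F ν K s.Ω) k (fun n => cR * epsOfRecord ν g n) W)
    (hsol : W ∈ solvableDom (avOfRecord F N K) (regMSCoPOfRecord F N ν K k s.Ω) (genSet s.Ω k)) :
    ∀ n, n ≤ k → Sect2.CoDivSmallOn (Sect2.omegaBondsTop s.Ω (suppDomOfRecord F ν K s.Ω) n) (B₃ * (cR * epsOfRecord ν g n) * (F.P K).eta n ^ 3) (UbgMSCoPOfRecord F N ν M g K k s W) :=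
  coDivSmallOn_of_thm1RegSepTop7M h15 ν M g K k cR s hsep hM₁ hnum ha₀ hcomp hcomp' h7 (isMinimizer_UbgMSCoPOfRecord ν M g K k s hsol)

/-- **★★★ ROW P11's BODY AT `(s, 𝐖)` FOR def-R's COLLAR-CLASS MINIMISER `UbgMSCoPOfRecord … s 𝐖`, FROM THE GUARDED `CoP` FACT** — the v1.5 `Record13SepCoP` `bg` row's supplier on the fact WITH print's `M₁ ≥ 1`: on the
solvable set §2's `bgRowAtDatumU_of_thm1RegSepTop7MC1` at `isMinimizer_UbgMSCoPOfRecord`, off it the junk `1` by FILE 10's `bgRowAtDatum_one`.  Hypotheses: the `CoP` fact, print's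
(7) on the datum over the support (`h7 : Sect2.DataSmall7PTop …`), the displayed C¹ class clause for the minimiser on the solvable set ([15] Thm 1 (9)–(10), gauge-free reading), the
numerics∕letters of FILE 11's ★★★ theorem, `hcomp` AND `hcomp'`, `hM₁` — and NO `h9`.
[cite: Balaban1985Variational, Thm 1 (2),(6)–(10) pp.278–279; Balaban1988Convergent, p.255, (2.6)–(2.8) pp.255–256, (2.12) p.256, (2.27)–(2.28) p.259, (2.34)–(2.41) p.261; Balaban1987RG1, (1.11)–(1.16) p.262] -/
theorem bgRowAtDatumCoP_of_thm1RegSepCoP7MC1 {B₃ B₃' a₀ a₁ tI tMS : ℝ} (h15 : VariationalThm1RegSepCoP7M F N B₃ a₀ a₁)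
    (S : Sect2.Setting (MatA N) (SU N)) (hι : S.ι = ιSU N) (h𝓜 : S.𝓜 = B12RegularSpaces111SpecialUnitary.suModel N) (hS : S.Laws) (hpos : S.Pos)
    (ν : Stage7Numerics) {M : ℕ} (hM : 0 < M) (K k : ℕ) (cR : ℝ) (hB₃ : 0 ≤ B₃) (hB₃' : 0 ≤ B₃')
    (hg : ∀ j, 1 ≤ j → j ≤ k → 0 < S.flow.g j ∧ S.flow.g j ^ 2 ≤ Real.exp (-1)) (hpq : ν.p₀ ≤ S.lf.q₀)
    (hnum : ∀ n, n ≤ k → 0 < cR * epsOfRecord ν S.flow.g n ∧ cR * epsOfRecord ν S.flow.g n ≤ a₁ ∧ B₃ * (cR * epsOfRecord ν S.flow.g n) ≤ ν.εreg)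
    (ha₀ : ν.εreg ≤ a₀) (hcomp : ∀ n, n < k → cR * epsOfRecord ν S.flow.g n ≤ 2 * (cR * epsOfRecord ν S.flow.g (n + 1)))
    (hcomp' : ∀ n, n < k → cR * epsOfRecord ν S.flow.g (n + 1) ≤ 2 * (cR * epsOfRecord ν S.flow.g n))
    (hα : ∀ n, 1 ≤ n → n ≤ k → 0 < S.lf.alpha0 (S.flow.g n) ∧ 0 < S.lf.alpha1 (S.flow.g n))
    (hBα : ∀ n, 1 ≤ n → n ≤ k → B₃ * (cR * epsOfRecord ν S.flow.g n) ≤ (1 - S.βc) * S.lf.alpha0 (S.flow.g n))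
    (hΛI0 : 0 ≤ (4 * (B₃ + (((F.P K).d - 1 : ℕ) : ℝ) * (((F.P K).L : ℝ) * M) * B₃') + 16 * ((((F.P K).d - 1 : ℕ) : ℝ) * (((F.P K).L : ℝ) * M)) ^ 2 * B₃ ^ 2 * a₁) * cR * ν.A₀)
    (hΛI : (4 * (B₃ + (((F.P K).d - 1 : ℕ) : ℝ) * (((F.P K).L : ℝ) * M) * B₃') + 16 * ((((F.P K).d - 1 : ℕ) : ℝ) * (((F.P K).L : ℝ) * M)) ^ 2 * B₃ ^ 2 * a₁) * cR * ν.A₀ ≤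
      tI * S.lf.C₀) (htI : tI < S.cB)
    (hΛMS0 : 0 ≤ (4 * (B₃ + (((F.P K).d - 1 : ℕ) : ℝ) * (M : ℝ) * B₃') + 16 * ((((F.P K).d - 1 : ℕ) : ℝ) * (M : ℝ)) ^ 2 * B₃ ^ 2 * a₁) * cR * ν.A₀)
    (hΛMS : (4 * (B₃ + (((F.P K).d - 1 : ℕ) : ℝ) * (M : ℝ) * B₃') + 16 * ((((F.P K).d - 1 : ℕ) : ℝ) * (M : ℝ)) ^ 2 * B₃ ^ 2 * a₁) * cR * ν.A₀ ≤ tMS * S.lf.C₀)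
    (htMS : tMS < S.B * S.C * S.Mr)
    (hsN : ∀ n, 1 ≤ n → n ≤ k + 1 → ((B14.Eq213MaximalDomains.side (F.P K).L M n : ℕ) : ℤ) < (F.P K).sitesPerDir 0)
    (hcB : 2 * (((F.P K).d - 1 : ℕ) : ℝ) * ((F.P K).L * M) < S.cB) (hBCM : 2 * (((F.P K).d - 1 : ℕ) : ℝ) * M < S.B * S.C * S.Mr)
    (hsmallI : ∀ j, 1 ≤ j → j ≤ k → (((F.P K).d - 1 : ℕ) : ℝ) * ((F.P K).L * M) * (F.P K).eta j * (B₃ * (cR * epsOfRecord ν S.flow.g j)) ≤ 1 / 2)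
    (hsmallMS : ∀ n, 1 ≤ n → n ≤ k → (((F.P K).d - 1 : ℕ) : ℝ) * M * (F.P K).eta n * (B₃ * (cR * epsOfRecord ν S.flow.g n)) ≤ 1 / 2)
    (hC1 : ∀ j, 1 ≤ j → j ≤ k → ∃ t : ℕ, 0 < t ∧ RkOfRecord (F.P K).L ν.r (S.flow.g j) = (F.P K).L * t)
    (hC2 : ∀ j, 1 ≤ j → j ≤ k → dCubeSide (F.P K).L M (RkOfRecord (F.P K).L ν.r (S.flow.g j)) j ∣ (F.P K).sitesPerDir 0)
    (s : SeqOfRecord F ν M S.flow.g K k) (hsep : Sect2.SeqSeparated ν.M₁ s) (hM₁ : 0 < ν.M₁) (W : MSField (F.P K) (SU N))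
    (h7 : Sect2.DataSmall7PTop (avOfRecord F N K) s.Ω (suppDomOfRecord F ν K s.Ω) k (fun n => cR * epsOfRecord ν S.flow.g n) W)
    (hclassC1 : W ∈ solvableDom (avOfRecord F N K) (regMSCoPOfRecord F N ν K k s.Ω) (genSet s.Ω k) →
      ∀ n, 1 ≤ n → n ≤ k → PlaqC1SmallOn (plaqInside (s.Ω n)) (B₃' * (cR * epsOfRecord ν S.flow.g n) * (F.P K).eta n ^ 3) (UbgMSCoPOfRecord F N ν M S.flow.g K k s W)) :
    ∀ j, 1 ≤ j → j ≤ k → ∀ X : (Sect2.domSys (F.P K) M j).Dom,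
      (Sect2.domSites (F.P K) M j X ⊆ s.Λ j →
        Sect2.ofBackgroundC S.ι (UbgMSCoPOfRecord F N ν M S.flow.g K k s W) ∈
          Sect2.spaceI S (Sect2.Residual.unit (F.P K) (MatA N)) M j (Sect2.domSites (F.P K) M j X) (S.lf.alpha0 (S.flow.g j)) (S.lf.alpha1 (S.flow.g j))) ∧
      (Sect2.admB (F.P K) ν M S.flow.g s.Ω s.Λ j (Sect2.domSites (F.P K) M j X) = true →
        Sect2.ofBackgroundC S.ι (UbgMSCoPOfRecord F N ν M S.flow.g K k s W) ∈
          Sect2.spaceMS S (Sect2.Residual.unit (F.P K) (MatA N)) M j (Sect2.domSites (F.P K) M j X) s.Ω) := by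
  by_cases hsol : W ∈ solvableDom (avOfRecord F N K) (regMSCoPOfRecord F N ν K k s.Ω) (genSet s.Ω k)
  · exact bgRowAtDatumU_of_thm1RegSepTop7MC1 h15 S hι h𝓜 hS hpos ν hM K k cR hB₃ hB₃' hg hpq hnum ha₀ hcomp hcomp' hα hBα hΛI0 hΛI htI hΛMS0 hΛMS htMS
      hsN hcB hBCM hsmallI hsmallMS hC1 hC2 s hsep hM₁ h7 (isMinimizer_UbgMSCoPOfRecord ν M S.flow.g K k s hsol) (hclassC1 hsol)
  · rw [UbgMSCoPOfRecord_eq_one_of_not_mem ν M S.flow.g K k s hsol]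
    exact bgRowAtDatum_one S hpos ν M K k s hα


end AtRecordCoPM

end Literature.MathematicalPhysics.QuantumFieldTheory.Balaban1983to89.Node00

end
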